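import Literature.Probability.Percolation.BergKahnLogSupermodular
import HarnessLib

/-!
# Attachments to the terminal set are positively correlated given that the port is isolated from it

Support file for crux `stmt-CriticalPhenomena-4575` (`NoHeavyLowerTail`), lead seat `prim-nh-lead-4575` gen 127
(`--supports stmt-CriticalPhenomena-4575`); memo `run/shared/lean/prim/prim-sahi/FROM-prim-nh-lead-4575-g127-XS-HESSIAN.md` §3
(the sign of the `C`-interaction term in the port-cube Hessian of `Φ₄ − C`).  No definitions, no sorries, standard axioms.

Bernoulli bond percolation `μ = prodBernoulli w` with arbitrary edge probabilities on a finite vertex type, a finite ROOT SET `S`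
(in the application `S = {s, a, b}`, the terminals), a PORT `c` and two further vertices `x, y` (in the application: two neighbours of
the port).  Write `D = {S ↛ c}` for the event that no root is joined to `c` by an open path (the port is isolated from the terminals,
`c ∤ T`, whose probability is the coordinate `C = I′_c` of the lane's quartic law `V4`), and `A_x = {S ↔ x}` for the event that SOME
root is joined to `x`.  Then

  `μ(D ∩ A_x) · μ(D ∩ A_y) ≤ μ(D ∩ A_x ∩ A_y) · μ(D)`,

i.e. **conditionally on the port being isolated from the terminal set, the attachment events of two other vertices to the terminal
set are positively correlated** (`attach_posCorr_given_groupIso`).  This is an inclusion–exclusion rewriting of van den Berg–Kahn's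
log-supermodularity of group-avoidance probabilities `P(S ↛ X)P(S ↛ Y) ≤ P(S ↛ X ∩ Y)P(S ↛ X ∪ Y)` [van den Berg–Kahn 2001, Thm 1.2 and
Remark 3], which is a theorem of the tree (`Literature.Probability.Percolation.BergKahn.bergKahn_groupAvoidance`), applied to
`X = {x, c}`, `Y = {y, c}`.  In the port-cube calculus of THEOREM R♯ (prim-l12-p1 gen 26) it says that the joint pivotality of two cube
pairs for `C` dominates the product of the single pivotalities, `Ĉ_ef ≥ Ĉ_e·Ĉ_f` (memo §3: the `C`-interaction term of the cube Hessian
of `log(Φ₄/C)` is always `≤ 0`).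
* `ie_algebra` — the real-arithmetic step `px·py ≤ d·z ⟹ (d−px)(d−py) ≤ (d−px−py+z)·d`;
* `attach_posCorr_given_groupIso` — the inequality above for an arbitrary finite root set `S`.
-/

noncomputable section

namespace Summit.CriticalPhenomena.PercolationContinuityZ3.Theorems.PortAttachmentCorrelation

open MeasureTheory Set Literature.Probability.Percolation Literature.Probability.LatticeModels
open scoped Classical

variable {V : Type} [Fintype V] [DecidableEq V]

/-- The arithmetic of inclusion–exclusion: if `px·py ≤ d·z` then `(d − px)(d − py) ≤ (d − px − py + z)·d`. [this work] -/
theorem ie_algebra {d px py z : ℝ} (h : px * py ≤ d * z) : (d - px) * (d - py) ≤ (d - px - py + z) * d := by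
  have e : (d - px - py + z) * d - (d - px) * (d - py) = d * z - px * py := by ring
  linarith

/-- **Attachments to the root set are positively correlated given that the port avoids the root set.**  For `μ = prodBernoulli w`
on a finite vertex type, a finite root set `S`, a port `c` and vertices `x, y`, with `D = {∀ s ∈ S, s ↛ c}` and `A_v = {∃ s ∈ S, s ↔ v}`:
`μ(D ∩ A_x)·μ(D ∩ A_y) ≤ μ(D ∩ A_x ∩ A_y)·μ(D)` — van den Berg–Kahn's group-avoidance log-supermodularity
[cite: VandenbergKahn2001, Thm 1.2 and Remark 3 (pp. 123–124)] (`BergKahn.bergKahn_groupAvoidance`) with `X = {x, c}`, `Y = {y, c}`,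
rewritten by inclusion–exclusion; the resulting positive correlation is van den Berg–Kahn's Theorem 1.1 in the root-set form of their Remark 3
[cite: VandenbergKahn2001, Thm 1.1 and Remark 3 (p. 124)] (attribution: prim-sahi LITERATURE §74, finding L74-1). -/
theorem attach_posCorr_given_groupIso (w : Sym2 V → unitInterval) (S : Finset V) (c x y : V) :
    (prodBernoulli w).real {ω : BondConfig V | (∀ s ∈ S, ω ∉ openConn s c) ∧ ∃ s ∈ S, ω ∈ openConn s x} *
        (prodBernoulli w).real {ω : BondConfig V | (∀ s ∈ S, ω ∉ openConn s c) ∧ ∃ s ∈ S, ω ∈ openConn s y} ≤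
      (prodBernoulli w).real
          {ω : BondConfig V | (∀ s ∈ S, ω ∉ openConn s c) ∧ (∃ s ∈ S, ω ∈ openConn s x) ∧ ∃ s ∈ S, ω ∈ openConn s y} *
        (prodBernoulli w).real {ω : BondConfig V | ∀ s ∈ S, ω ∉ openConn s c} := by
  set μ := prodBernoulli w with hμ
  -- the three avoidance events
  set D : Set (BondConfig V) := {ω | ∀ s ∈ S, ω ∉ openConn s c} with hD
  set Rx : Set (BondConfig V) := {ω | ∀ s ∈ S, ω ∉ openConn s x} with hRx
  set Ry : Set (BondConfig V) := {ω | ∀ s ∈ S, ω ∉ openConn s y} with hRy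
  -- van den Berg–Kahn for `X = {x} ∪ {c}`, `Y = {y} ∪ {c}`
  have hBK := BergKahn.bergKahn_groupAvoidance w S ({x} ∪ {c} : Set V) ({y} ∪ {c} : Set V)
  have eX : {ω : BondConfig V | ∀ s ∈ S, ∀ z ∈ ({x} ∪ {c} : Set V), ω ∉ openConn s z} = D ∩ Rx := by
    ext ω
    simp only [mem_setOf_eq, mem_inter_iff, mem_union, mem_singleton_iff, hD, hRx]
    constructor
    · intro h
      exact ⟨fun s hs => h s hs c (Or.inr rfl), fun s hs => h s hs x (Or.inl rfl)⟩
    · rintro ⟨h1, h2⟩ s hs z hz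
      rcases hz with rfl | rfl
      exacts [h2 s hs, h1 s hs]
  have eY : {ω : BondConfig V | ∀ s ∈ S, ∀ z ∈ ({y} ∪ {c} : Set V), ω ∉ openConn s z} = D ∩ Ry := by
    ext ω
    simp only [mem_setOf_eq, mem_inter_iff, mem_union, mem_singleton_iff, hD, hRy]
    constructor
    · intro h
      exact ⟨fun s hs => h s hs c (Or.inr rfl), fun s hs => h s hs y (Or.inl rfl)⟩
    · rintro ⟨h1, h2⟩ s hs z hz
      rcases hz with rfl | rfl
      exacts [h2 s hs, h1 s hs]
  have eXY : {ω : BondConfig V | ∀ s ∈ S, ∀ z ∈ (({x} ∪ {c}) ∪ ({y} ∪ {c}) : Set V), ω ∉ openConn s z} = D ∩ Rx ∩ Ry := by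
    ext ω
    simp only [mem_setOf_eq, mem_inter_iff, mem_union, mem_singleton_iff, hD, hRx, hRy]
    constructor
    · intro h
      exact ⟨⟨fun s hs => h s hs c (Or.inl (Or.inr rfl)), fun s hs => h s hs x (Or.inl (Or.inl rfl))⟩,
        fun s hs => h s hs y (Or.inr (Or.inl rfl))⟩
    · rintro ⟨⟨h1, h2⟩, h3⟩ s hs z hz
      rcases hz with (rfl | rfl) | (rfl | rfl)
      exacts [h2 s hs, h1 s hs, h3 s hs, h1 s hs]
  have sub : {ω : BondConfig V | ∀ s ∈ S, ∀ z ∈ (({x} ∪ {c}) ∩ ({y} ∪ {c}) : Set V), ω ∉ openConn s z} ⊆ D := by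
    intro ω h s hs
    exact h s hs c ⟨Or.inr rfl, Or.inr rfl⟩
  rw [eX, eY, eXY] at hBK
  -- the four numbers
  set d : ℝ := μ.real D with hd
  set px : ℝ := μ.real (D ∩ Rx) with hpx
  set py : ℝ := μ.real (D ∩ Ry) with hpy
  set z : ℝ := μ.real (D ∩ Rx ∩ Ry) with hz
  have hmid : μ.real {ω : BondConfig V | ∀ s ∈ S, ∀ z ∈ (({x} ∪ {c}) ∩ ({y} ∪ {c}) : Set V), ω ∉ openConn s z} ≤ d :=
    measureReal_mono sub (measure_ne_top μ _)
  have hz0 : 0 ≤ z := measureReal_nonneg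
  have key : px * py ≤ d * z := hBK.trans (mul_le_mul_of_nonneg_right hmid hz0)
  -- inclusion–exclusion: the attachment events are the complements of the avoidance events inside `D`
  have eAx : {ω : BondConfig V | (∀ s ∈ S, ω ∉ openConn s c) ∧ ∃ s ∈ S, ω ∈ openConn s x} = D \ Rx := by
    ext ω
    simp only [mem_setOf_eq, mem_sdiff, hD, hRx, not_forall, not_not, exists_prop]
  have eAy : {ω : BondConfig V | (∀ s ∈ S, ω ∉ openConn s c) ∧ ∃ s ∈ S, ω ∈ openConn s y} = D \ Ry := by
    ext ω
    simp only [mem_setOf_eq, mem_sdiff, hD, hRy, not_forall, not_not, exists_prop]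
  have eAxy : {ω : BondConfig V | (∀ s ∈ S, ω ∉ openConn s c) ∧ (∃ s ∈ S, ω ∈ openConn s x) ∧ ∃ s ∈ S, ω ∈ openConn s y} =
      (D \ Rx) \ Ry := by
    ext ω
    simp only [mem_setOf_eq, mem_sdiff, hD, hRx, hRy, not_forall, not_not, exists_prop, and_assoc]
  have mRx : MeasurableSet Rx := MeasurableSet.of_discrete
  have mRy : MeasurableSet Ry := MeasurableSet.of_discrete
  have i1 : μ.real (D ∩ Rx) + μ.real (D \ Rx) = μ.real D := measureReal_inter_add_sdiff (μ := μ) (s := D) mRx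
  have i2 : μ.real (D ∩ Ry) + μ.real (D \ Ry) = μ.real D := measureReal_inter_add_sdiff (μ := μ) (s := D) mRy
  have i3 : μ.real ((D \ Rx) ∩ Ry) + μ.real ((D \ Rx) \ Ry) = μ.real (D \ Rx) := measureReal_inter_add_sdiff (μ := μ) (s := D \ Rx) mRy
  have e4 : (D \ Rx) ∩ Ry = (D ∩ Ry) \ Rx := by
    ext ω; simp only [mem_inter_iff, mem_sdiff]; tauto
  have i4 : μ.real ((D ∩ Ry) ∩ Rx) + μ.real ((D ∩ Ry) \ Rx) = μ.real (D ∩ Ry) := measureReal_inter_add_sdiff (μ := μ) (s := D ∩ Ry) mRx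
  have e5 : (D ∩ Ry) ∩ Rx = D ∩ Rx ∩ Ry := by
    ext ω; simp only [mem_inter_iff]; tauto
  rw [e5] at i4
  rw [e4] at i3
  have vAx : μ.real (D \ Rx) = d - px := by linarith
  have vAy : μ.real (D \ Ry) = d - py := by linarith
  have vAxy : μ.real ((D \ Rx) \ Ry) = d - px - py + z := by linarith
  rw [eAx, eAy, eAxy, vAx, vAy, vAxy]
  exact ie_algebra key

/-- **The three-terminal instance in the port orientation of THEOREM R♯.**  For terminals `s a b`, port `c` and two further vertices
`x y`, with `D = (c↔s)ᶜ ∩ (c↔a)ᶜ ∩ (c↔b)ᶜ` (the port is isolated from `T = {s,a,b}`; `μ(D) = C = I′_c`) and `A_v = (v↔s) ∪ (v↔a) ∪ (v↔b)`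
(`v` is attached to `T`): `μ(D ∩ A_x)·μ(D ∩ A_y) ≤ μ(D ∩ A_x ∩ A_y)·μ(D)`.  In the cube calculus: the joint pivotality of two cube pairs for
`C` dominates the product of their pivotalities, `Ĉ_ef ≥ Ĉ_e·Ĉ_f` (the inequality itself is van den Berg–Kahn 2001, Thm 1.1 with Remark 3;
the port-cube reading is this work's). [cite: VandenbergKahn2001, Thm 1.1 and Remark 3 (p. 124)] -/
theorem attach_posCorr_given_portIso (w : Sym2 V → unitInterval) (s a b c x y : V) :
    (prodBernoulli w).real (((openConn c s)ᶜ ∩ (openConn c a)ᶜ ∩ (openConn c b)ᶜ) ∩ (openConn x s ∪ openConn x a ∪ openConn x b) :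
          Set (BondConfig V)) *
        (prodBernoulli w).real (((openConn c s)ᶜ ∩ (openConn c a)ᶜ ∩ (openConn c b)ᶜ) ∩ (openConn y s ∪ openConn y a ∪ openConn y b) :
          Set (BondConfig V)) ≤
      (prodBernoulli w).real (((openConn c s)ᶜ ∩ (openConn c a)ᶜ ∩ (openConn c b)ᶜ) ∩ (openConn x s ∪ openConn x a ∪ openConn x b) ∩
            (openConn y s ∪ openConn y a ∪ openConn y b) : Set (BondConfig V)) *
        (prodBernoulli w).real ((openConn c s)ᶜ ∩ (openConn c a)ᶜ ∩ (openConn c b)ᶜ : Set (BondConfig V)) := by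
  have h := attach_posCorr_given_groupIso w ({s, a, b} : Finset V) c x y
  -- symmetry of the connection event (`openConn u v = openConn v u`; cf. `Literature.Barriers.CriticalPhenomena.openConn_comm'`)
  have comm : ∀ u v : V, (openConn u v : Set (BondConfig V)) = openConn v u := fun u v => by
    ext ω
    exact ⟨fun hh => SimpleGraph.Reachable.symm hh, fun hh => SimpleGraph.Reachable.symm hh⟩
  have eD : {ω : BondConfig V | ∀ t ∈ ({s, a, b} : Finset V), ω ∉ openConn t c} =
      ((openConn c s)ᶜ ∩ (openConn c a)ᶜ ∩ (openConn c b)ᶜ : Set (BondConfig V)) := by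
    ext ω
    simp only [mem_setOf_eq, Finset.mem_insert, Finset.mem_singleton, forall_eq_or_imp, forall_eq, mem_inter_iff, mem_compl_iff,
      comm c s, comm c a, comm c b, and_assoc]
  have eA : ∀ v : V, {ω : BondConfig V | ∃ t ∈ ({s, a, b} : Finset V), ω ∈ openConn t v} =
      (openConn v s ∪ openConn v a ∪ openConn v b : Set (BondConfig V)) := by
    intro v
    ext ω
    simp only [mem_setOf_eq, Finset.mem_insert, Finset.mem_singleton, exists_eq_or_imp, exists_eq_left, mem_union,
      comm v s, comm v a, comm v b, or_assoc]
  have e1 : {ω : BondConfig V | (∀ t ∈ ({s, a, b} : Finset V), ω ∉ openConn t c) ∧ ∃ t ∈ ({s, a, b} : Finset V), ω ∈ openConn t x} =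
      ((openConn c s)ᶜ ∩ (openConn c a)ᶜ ∩ (openConn c b)ᶜ) ∩ (openConn x s ∪ openConn x a ∪ openConn x b) := by
    rw [← eD, ← eA x]; ext ω; simp only [mem_setOf_eq, mem_inter_iff]
  have e2 : {ω : BondConfig V | (∀ t ∈ ({s, a, b} : Finset V), ω ∉ openConn t c) ∧ ∃ t ∈ ({s, a, b} : Finset V), ω ∈ openConn t y} =
      ((openConn c s)ᶜ ∩ (openConn c a)ᶜ ∩ (openConn c b)ᶜ) ∩ (openConn y s ∪ openConn y a ∪ openConn y b) := by
    rw [← eD, ← eA y]; ext ω; simp only [mem_setOf_eq, mem_inter_iff]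
  have e3 : {ω : BondConfig V | (∀ t ∈ ({s, a, b} : Finset V), ω ∉ openConn t c) ∧ (∃ t ∈ ({s, a, b} : Finset V), ω ∈ openConn t x) ∧
        ∃ t ∈ ({s, a, b} : Finset V), ω ∈ openConn t y} =
      ((openConn c s)ᶜ ∩ (openConn c a)ᶜ ∩ (openConn c b)ᶜ) ∩ (openConn x s ∪ openConn x a ∪ openConn x b) ∩
        (openConn y s ∪ openConn y a ∪ openConn y b) := by
    rw [← eD, ← eA x, ← eA y]; ext ω; simp only [mem_setOf_eq, mem_inter_iff, and_assoc]
  rw [e1, e2, e3, eD] at h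
  exact h

end Summit.CriticalPhenomena.PercolationContinuityZ3.Theorems.PortAttachmentCorrelation

end
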